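import Summits.HodgeConjecture.HodgeConjecture.Theorems.F0P3bBorelCharactersUnipotentTwo   -- ★ `antidiagonal_two_over_eq`, `coe_eq_of_mem_unipotentU_two`, `coe_glDiagonal_two_mul_mul_inv_apply` (brings ★ `UnitaryGroupBorelInduction`: `torusU`, `unipotentU`)
import HarnessLib

/-!
# F0 · P3c · line LH6 «StCharTS» — ROAD «UP-TR» brick (H4s), sub-road «JAC-LOC₂» file (B1) «U2-CHART»: the big-cell coordinates of the quasi-split
# `U(1,1) = U(σ, Φ₂)(R)` — entries criterion, the elements `u(y)`, `ū(z)`, `m(d, e)`, `w₀`, the inverse, and the exact `2 × 2` conjugation identities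
# behind the ORBIT-TUBE identity at the split torus (Rogawski 1990 §1.10 p. 9, §12.5 p. 182; Harish-Chandra 1970 Lemma 22; Casselman 1995 Prop. 1.4.4)

Cell `pub/hodgecm-mathlib`, crux H413 = `stmt-HodgeConjecture-24833` (lane `--supports … --as helper`); seat LH7-p02 (g8), typing hand of brick (H4s) «JAC-H-SPLIT» of
ROAD «UP-TR» (holder F0P3-p02 (g23)); sub-road «JAC-LOC₂» memo `F0/P3c/LH7/LH7-p02/g8/h4s/ROAD-JAC-LOC2.v1.LH7p02g8.md` §1–§2.  THEOREMS ONLY; sorry-free;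
no definition ∕ instance ∕ notation ∕ named fact; imports ★ only; axioms TRIO.  PURE ALGEBRA over a commutative ring `R` with a ring endomorphism `σ` (involutive
where said), `J = Φ₂ = !![0, 1; 1, 0]` (hypothesis `hJ : J = (StdForm.antidiagonal 2).over R` as in ★ `borelTriple`).

WHAT (no new definitions — elements are members of `U(σ, Φ₂)(R) ≤ GL₂(R)` with a prescribed MATRIX):
* §1 `mem_unitaryGroupOfForm_two_iff` — `g ∈ U(σ,Φ₂)` iff the four entry identities `σg₀₀ g₁₀ + σg₁₀ g₀₀ = 0`, `σg₀₀ g₁₁ + σg₁₀ g₀₁ = 1`, `σg₀₁ g₁₀ + σg₁₁ g₀₀ = 1`,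
  `σg₀₁ g₁₁ + σg₁₁ g₀₁ = 0`; `coe_inv_eq_of_mem` — `g⁻¹ = !![σg₁₁, σg₀₁; σg₁₀, σg₀₀]`.
* §2 the chart elements EXIST in `U(σ,Φ₂)(R)`: `exists_upper` (`u(y) = !![1, y; 0, 1]`, `y + σy = 0`), `exists_lower` (`ū(z) = !![1, 0; z, 1]`), `exists_diag`
  (`m(d, e) = !![d, 0; 0, e]`, `σd · e = 1`, `σe · d = 1`), `exists_weylTwo` (`w₀ = !![0, 1; 1, 0]`); and the coordinates of members: `entry_add_map_entry_eq_zero_of_mem_unipotentU`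
  (`y + σy = 0` for `u ∈ N`), `coe_eq_diag_of_mem_torusU` + `map_entry_mul_entry_eq_one_of_mem_torusU` (`t ∈ M` is `!![d, 0; 0, e]` with `σd·e = 1`).
* §3 the `2 × 2` identities (plain matrices): `diag_mul_upper_mul_diag`, `diag_mul_lower_mul_diag` (conjugating `u(y)`, `ū(z)` by a diagonal), `lower_mul_upper`,
  `upper_mul_lower_mul_upper` (`u(y′) ū(z₁) u(−y) = !![1 + y′z₁, y′ − y − y y′ z₁; z₁, 1 − z₁ y]`) and `lower_mul_upper_mul_lower` (the opposite orientation), and BOTH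
  Iwahori REFACTORISATIONS of `!![p, q; r, s]`: `eq_upper_mul_diag_mul_lower` (`N·M·N̄`, `s′ s = 1`: `= u(q s′) · m(p − q s′ r, s) · ū(s′ r)`, the order of ★
  `exists_unitriangular_mul_lower_of_mem_unitary_congruenceGL`) and `eq_lower_mul_diag_mul_upper` (`N̄·M·N`, `p′ p = 1`, the order of ★ `F0P3cIwahoriDatumU2Alg.coe_level_eq_mul`).
* §4 in the group: `coe_conj_upper_of_diag` (`m⁻¹ u(y) m = u(d⁻¹ y e)`), `coe_conj_lower_of_diag` (`m⁻¹ ū(z) m = ū(e⁻¹ z d)`), i.e. the TWIST of the van Dijk road: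
  for `m = m(d, σd⁻¹)` the root value is `a = d·σd` and `m⁻¹ u(y) m = u(y ∕ a)`, `m⁻¹ ū(z) m = ū(a z)`.
HONEST LABEL: count-neutral algebra; closes no organ; HC_CM is proved only modulo the 7 printed citations (2 remaining: hLiu418 = `stmt-HodgeConjecture-24832`, h413 =
`stmt-HodgeConjecture-24833`) until rung 0 closes.

## References
* [Rogawski1990] J. D. Rogawski, *Automorphic Representations of Unitary Groups in Three Variables*, Ann. of Math. Stud. 123 (1990), §1.9–§1.10 pp. 8–9 (the groups `B`, `M`,
  `N` of a quasi-split unitary group), §12.5 p. 182 (Weyl integration formula).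
* [Casselman1995] W. Casselman, *Introduction to the theory of admissible representations of `p`-adic reductive groups* (1995 notes), Prop. 1.4.4 (Iwahori factorisation).
* [HarishChandra1970] Harish-Chandra (notes by G. van Dijk), *Harmonic analysis on reductive p-adic groups*, LNM 162 (1970), Part V §4 Lemma 22.
-/

set_option autoImplicit false
-- the mandated namespace has the single-problem summit's repeated segment (`HodgeConjecture.HodgeConjecture`)
set_option linter.dupNamespace false

open Matrix
open Literature.NumberTheory.Automorphic Literature.NumberTheory.Automorphic.UnitaryGroup
open Summit.HodgeConjecture.HodgeConjecture.Cruxes.H413.F0P3bBorelCharactersUnipotentTwo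
open scoped MatrixGroups

namespace Summit.HodgeConjecture.HodgeConjecture.Cruxes.H413.F0P3cStCharTSUpTrU2Chart

/-! ## §1 Membership in `U(σ, Φ₂)` by entries; the inverse -/

section Membership

variable {R : Type*} [CommRing R] (σ : R →+* R) {J : Matrix (Fin 2) (Fin 2) R} (hJ : J = (StdForm.antidiagonal 2).over R)

omit σ in
/-- The `(i, j)` entry of `(σg)ᵀ Φ₂ g` is `σ(g_{0i}) g_{1j} + σ(g_{1i}) g_{0j}`. [cite: Rogawski1990, §1.9 p. 8] -/
theorem transpose_map_mul_antidiag_mul_apply (σ : R →+* R) (g : Matrix (Fin 2) (Fin 2) R) (i j : Fin 2) :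
    ((g.map σ)ᵀ * !![(0 : R), 1; 1, 0] * g) i j = σ (g 0 i) * g 1 j + σ (g 1 i) * g 0 j := by
  simp only [Matrix.mul_apply, Fin.sum_univ_two, Matrix.transpose_apply, Matrix.map_apply]
  fin_cases i <;> fin_cases j <;> simp <;> ring

include hJ in
/-- **`g ∈ U(σ, Φ₂)(R)` by entries**: the four identities `σg₀₀ g₁₀ + σg₁₀ g₀₀ = 0`, `σg₀₀ g₁₁ + σg₁₀ g₀₁ = 1`, `σg₀₁ g₁₀ + σg₁₁ g₀₀ = 1`, `σg₀₁ g₁₁ + σg₁₁ g₀₁ = 0`.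
[cite: Rogawski1990, §1.9 p. 8] -/
theorem mem_unitaryGroupOfForm_two_iff (g : GL (Fin 2) R) :
    g ∈ unitaryGroupOfForm σ J ↔
      σ ((g : Matrix (Fin 2) (Fin 2) R) 0 0) * (g : Matrix (Fin 2) (Fin 2) R) 1 0 + σ ((g : Matrix (Fin 2) (Fin 2) R) 1 0) * (g : Matrix (Fin 2) (Fin 2) R) 0 0 = 0 ∧
      σ ((g : Matrix (Fin 2) (Fin 2) R) 0 0) * (g : Matrix (Fin 2) (Fin 2) R) 1 1 + σ ((g : Matrix (Fin 2) (Fin 2) R) 1 0) * (g : Matrix (Fin 2) (Fin 2) R) 0 1 = 1 ∧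
      σ ((g : Matrix (Fin 2) (Fin 2) R) 0 1) * (g : Matrix (Fin 2) (Fin 2) R) 1 0 + σ ((g : Matrix (Fin 2) (Fin 2) R) 1 1) * (g : Matrix (Fin 2) (Fin 2) R) 0 0 = 1 ∧
      σ ((g : Matrix (Fin 2) (Fin 2) R) 0 1) * (g : Matrix (Fin 2) (Fin 2) R) 1 1 + σ ((g : Matrix (Fin 2) (Fin 2) R) 1 1) * (g : Matrix (Fin 2) (Fin 2) R) 0 1 = 0 := by
  rw [mem_unitaryGroupOfForm_iff, hJ, antidiagonal_two_over_eq]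
  constructor
  · intro h
    have h00 := congrFun (congrFun h 0) 0
    have h01 := congrFun (congrFun h 0) 1
    have h10 := congrFun (congrFun h 1) 0
    have h11 := congrFun (congrFun h 1) 1
    rw [transpose_map_mul_antidiag_mul_apply] at h00 h01 h10 h11
    simp only [Matrix.of_apply, Matrix.cons_val', Matrix.cons_val_zero, Matrix.cons_val_one, Matrix.empty_val',
      Matrix.cons_val_fin_one] at h00 h01 h10 h11
    exact ⟨h00, h01, h10, h11⟩
  · rintro ⟨h00, h01, h10, h11⟩
    ext i j
    rw [transpose_map_mul_antidiag_mul_apply]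
    fin_cases i <;> fin_cases j <;> simp [h00, h01, h10, h11]

include hJ in
/-- **The inverse of a member of `U(σ, Φ₂)(R)`**: `g⁻¹ = Φ₂ (σg)ᵀ Φ₂ = !![σg₁₁, σg₀₁; σg₁₀, σg₀₀]`. [cite: Rogawski1990, §1.9 p. 8] -/
theorem coe_inv_eq_of_mem {g : GL (Fin 2) R} (hg : g ∈ unitaryGroupOfForm σ J) :
    ((g⁻¹ : GL (Fin 2) R) : Matrix (Fin 2) (Fin 2) R) =
      !![σ ((g : Matrix (Fin 2) (Fin 2) R) 1 1), σ ((g : Matrix (Fin 2) (Fin 2) R) 0 1); σ ((g : Matrix (Fin 2) (Fin 2) R) 1 0), σ ((g : Matrix (Fin 2) (Fin 2) R) 0 0)] := by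
  obtain ⟨h00, h01, h10, h11⟩ := (mem_unitaryGroupOfForm_two_iff σ hJ g).1 hg
  -- the displayed matrix is a left inverse of `g`, hence equals `g⁻¹`
  have hleft : !![σ ((g : Matrix (Fin 2) (Fin 2) R) 1 1), σ ((g : Matrix (Fin 2) (Fin 2) R) 0 1); σ ((g : Matrix (Fin 2) (Fin 2) R) 1 0), σ ((g : Matrix (Fin 2) (Fin 2) R) 0 0)] *
      (g : Matrix (Fin 2) (Fin 2) R) = 1 := by
    ext i j
    simp only [Matrix.mul_apply, Fin.sum_univ_two]
    fin_cases i <;> fin_cases j <;> simp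
    · linear_combination h10
    · linear_combination h11
    · linear_combination h00
    · linear_combination h01
  calc ((g⁻¹ : GL (Fin 2) R) : Matrix (Fin 2) (Fin 2) R)
      = (!![σ ((g : Matrix (Fin 2) (Fin 2) R) 1 1), σ ((g : Matrix (Fin 2) (Fin 2) R) 0 1); σ ((g : Matrix (Fin 2) (Fin 2) R) 1 0), σ ((g : Matrix (Fin 2) (Fin 2) R) 0 0)] *
          (g : Matrix (Fin 2) (Fin 2) R)) * ((g⁻¹ : GL (Fin 2) R) : Matrix (Fin 2) (Fin 2) R) := by rw [hleft, Matrix.one_mul]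
    _ = _ := by rw [Matrix.mul_assoc, ← Units.val_mul, mul_inv_cancel, Units.val_one, Matrix.mul_one]

end Membership

/-! ## §2 The chart elements exist in `U(σ, Φ₂)(R)`; coordinates of members of `N` and `M` -/

section Elements

variable {R : Type*} [CommRing R] (σ : R →+* R) {J : Matrix (Fin 2) (Fin 2) R} (hJ : J = (StdForm.antidiagonal 2).over R)

include hJ in
/-- **`u(y) = !![1, y; 0, 1] ∈ U(σ, Φ₂)(R)` for `y + σy = 0`** (and its inverse is `u(−y)`). [cite: Rogawski1990, §1.10 p. 9] -/
theorem exists_upper {y : R} (hy : y + σ y = 0) :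
    ∃ n : ↥(unitaryGroupOfForm σ J), ((n : GL (Fin 2) R) : Matrix (Fin 2) (Fin 2) R) = !![1, y; 0, 1] ∧
      (((n : GL (Fin 2) R)⁻¹ : GL (Fin 2) R) : Matrix (Fin 2) (Fin 2) R) = !![1, -y; 0, 1] := by
  have h1 : (!![(1 : R), y; 0, 1] : Matrix (Fin 2) (Fin 2) R) * !![1, -y; 0, 1] = 1 := by
    rw [Matrix.mul_fin_two, Matrix.one_fin_two]; simp
  have h2 : (!![(1 : R), -y; 0, 1] : Matrix (Fin 2) (Fin 2) R) * !![1, y; 0, 1] = 1 := by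
    rw [Matrix.mul_fin_two, Matrix.one_fin_two]; simp
  set g : GL (Fin 2) R := ⟨!![1, y; 0, 1], !![1, -y; 0, 1], h1, h2⟩ with hg
  have hσy : σ y = -y := by linear_combination hy
  have hmem : g ∈ unitaryGroupOfForm σ J := by
    rw [mem_unitaryGroupOfForm_two_iff σ hJ]
    simp [hg, hσy]
  exact ⟨⟨g, hmem⟩, rfl, rfl⟩

include hJ in
/-- **`ū(z) = !![1, 0; z, 1] ∈ U(σ, Φ₂)(R)` for `z + σz = 0`** (inverse `ū(−z)`). [cite: Rogawski1990, §1.10 p. 9] -/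
theorem exists_lower {z : R} (hz : z + σ z = 0) :
    ∃ n : ↥(unitaryGroupOfForm σ J), ((n : GL (Fin 2) R) : Matrix (Fin 2) (Fin 2) R) = !![1, 0; z, 1] ∧
      (((n : GL (Fin 2) R)⁻¹ : GL (Fin 2) R) : Matrix (Fin 2) (Fin 2) R) = !![1, 0; -z, 1] := by
  have h1 : (!![(1 : R), 0; z, 1] : Matrix (Fin 2) (Fin 2) R) * !![1, 0; -z, 1] = 1 := by
    rw [Matrix.mul_fin_two, Matrix.one_fin_two]; simp
  have h2 : (!![(1 : R), 0; -z, 1] : Matrix (Fin 2) (Fin 2) R) * !![1, 0; z, 1] = 1 := by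
    rw [Matrix.mul_fin_two, Matrix.one_fin_two]; simp
  set g : GL (Fin 2) R := ⟨!![1, 0; z, 1], !![1, 0; -z, 1], h1, h2⟩ with hg
  have hσz : σ z = -z := by linear_combination hz
  have hmem : g ∈ unitaryGroupOfForm σ J := by
    rw [mem_unitaryGroupOfForm_two_iff σ hJ]
    simp [hg, hσz]
  exact ⟨⟨g, hmem⟩, rfl, rfl⟩

include hJ in
/-- **`m(d, e) = !![d, 0; 0, e] ∈ U(σ, Φ₂)(R)` when `σd · e = 1` and `σe · d = 1`** (e.g. `e = (σd)⁻¹` for an involution `σ`); inverse `m(σe, σd)`.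
[cite: Rogawski1990, §1.10 p. 9] -/
theorem exists_diag {d e : R} (hde : σ d * e = 1) (hed : σ e * d = 1) :
    ∃ m : ↥(unitaryGroupOfForm σ J), ((m : GL (Fin 2) R) : Matrix (Fin 2) (Fin 2) R) = !![d, 0; 0, e] ∧
      (((m : GL (Fin 2) R)⁻¹ : GL (Fin 2) R) : Matrix (Fin 2) (Fin 2) R) = !![σ e, 0; 0, σ d] := by
  have hed' : d * σ e = 1 := by rw [mul_comm]; exact hed
  have hde' : e * σ d = 1 := by rw [mul_comm]; exact hde
  have h1 : (!![d, 0; 0, e] : Matrix (Fin 2) (Fin 2) R) * !![σ e, 0; 0, σ d] = 1 := by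
    rw [Matrix.mul_fin_two, Matrix.one_fin_two]; simp [hed', hde']
  have h2 : (!![σ e, 0; 0, σ d] : Matrix (Fin 2) (Fin 2) R) * !![d, 0; 0, e] = 1 := by
    rw [Matrix.mul_fin_two, Matrix.one_fin_two]; simp [hde, hed]
  set g : GL (Fin 2) R := ⟨!![d, 0; 0, e], !![σ e, 0; 0, σ d], h1, h2⟩ with hg
  have hmem : g ∈ unitaryGroupOfForm σ J := by
    rw [mem_unitaryGroupOfForm_two_iff σ hJ]
    simp [hg, hde, hed]
  exact ⟨⟨g, hmem⟩, rfl, rfl⟩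

include hJ in
/-- **The Weyl element `w₀ = !![0, 1; 1, 0] ∈ U(σ, Φ₂)(R)`** (`σ 1 = 1`); `w₀⁻¹ = w₀`. [cite: Rogawski1990, §1.10 p. 9] -/
theorem exists_weylTwo :
    ∃ w : ↥(unitaryGroupOfForm σ J), ((w : GL (Fin 2) R) : Matrix (Fin 2) (Fin 2) R) = !![0, 1; 1, 0] ∧
      (((w : GL (Fin 2) R)⁻¹ : GL (Fin 2) R) : Matrix (Fin 2) (Fin 2) R) = !![0, 1; 1, 0] := by
  have h1 : (!![(0 : R), 1; 1, 0] : Matrix (Fin 2) (Fin 2) R) * !![0, 1; 1, 0] = 1 := by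
    rw [Matrix.mul_fin_two, Matrix.one_fin_two]; simp
  set g : GL (Fin 2) R := ⟨!![0, 1; 1, 0], !![0, 1; 1, 0], h1, h1⟩ with hg
  have hmem : g ∈ unitaryGroupOfForm σ J := by
    rw [mem_unitaryGroupOfForm_two_iff σ hJ]
    simp [hg]
  exact ⟨⟨g, hmem⟩, rfl, rfl⟩

include hJ in
/-- **The coordinate of `u ∈ N` is `σ`-skew**: `u₀₁ + σ u₀₁ = 0` (the `(1,1)`… i.e. last entry identity of §1 at `u = !![1, u₀₁; 0, 1]`). [cite: Rogawski1990, §1.10 p. 9] -/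
theorem entry_add_map_entry_eq_zero_of_mem_unipotentU {u : ↥(unitaryGroupOfForm σ J)} (hu : u ∈ unipotentU σ J) :
    ((u : GL (Fin 2) R) : Matrix (Fin 2) (Fin 2) R) 0 1 + σ (((u : GL (Fin 2) R) : Matrix (Fin 2) (Fin 2) R) 0 1) = 0 := by
  subst hJ
  have hshape := coe_eq_of_mem_unipotentU_two σ hu
  obtain ⟨-, -, -, h11⟩ := (mem_unitaryGroupOfForm_two_iff σ rfl (u : GL (Fin 2) R)).1 u.2
  have e11 : ((u : GL (Fin 2) R) : Matrix (Fin 2) (Fin 2) R) 1 1 = 1 := by rw [hshape]; simp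
  rw [e11, map_one, mul_one, one_mul, add_comm] at h11
  exact h11

/-- **A member of the diagonal torus `M` is `!![t₀₀, 0; 0, t₁₁]`.** [cite: Rogawski1990, §1.10 p. 9] -/
theorem coe_eq_diag_of_mem_torusU {t : ↥(unitaryGroupOfForm σ J)} (ht : t ∈ torusU σ J) :
    ((t : GL (Fin 2) R) : Matrix (Fin 2) (Fin 2) R) = !![((t : GL (Fin 2) R) : Matrix (Fin 2) (Fin 2) R) 0 0, 0; 0, ((t : GL (Fin 2) R) : Matrix (Fin 2) (Fin 2) R) 1 1] := by
  obtain ⟨d, hd⟩ := (mem_torusU_iff t).1 ht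
  rw [← hd, coe_glDiagonal]
  ext i j
  fin_cases i <;> fin_cases j <;> simp [Matrix.diagonal]

include hJ in
/-- **The entries of `t ∈ M` satisfy `σ t₀₀ · t₁₁ = 1` and `σ t₁₁ · t₀₀ = 1`** (so `t₁₁ = (σ t₀₀)⁻¹`). [cite: Rogawski1990, §1.10 p. 9] -/
theorem map_entry_mul_entry_eq_one_of_mem_torusU {t : ↥(unitaryGroupOfForm σ J)} (ht : t ∈ torusU σ J) :
    σ (((t : GL (Fin 2) R) : Matrix (Fin 2) (Fin 2) R) 0 0) * ((t : GL (Fin 2) R) : Matrix (Fin 2) (Fin 2) R) 1 1 = 1 ∧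
      σ (((t : GL (Fin 2) R) : Matrix (Fin 2) (Fin 2) R) 1 1) * ((t : GL (Fin 2) R) : Matrix (Fin 2) (Fin 2) R) 0 0 = 1 := by
  have hshape := coe_eq_diag_of_mem_torusU σ ht
  obtain ⟨-, h01, h10, -⟩ := (mem_unitaryGroupOfForm_two_iff σ hJ (t : GL (Fin 2) R)).1 t.2
  have e10 : ((t : GL (Fin 2) R) : Matrix (Fin 2) (Fin 2) R) 1 0 = 0 := by rw [hshape]; simp
  have e01 : ((t : GL (Fin 2) R) : Matrix (Fin 2) (Fin 2) R) 0 1 = 0 := by rw [hshape]; simp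
  rw [e10, map_zero, zero_mul, add_zero] at h01
  rw [e01, map_zero, zero_mul, zero_add] at h10
  exact ⟨h01, h10⟩

end Elements

/-! ## §3 The `2 × 2` identities (plain matrices over `R`) -/

section Identities

variable {R : Type*} [CommRing R]

/-- `!![d′, 0; 0, e′] · u(y) · !![d, 0; 0, e] = !![d′d, d′ y e; 0, e′e]`. [cite: Rogawski1990, §1.10 p. 9] -/
theorem diag_mul_upper_mul_diag (d' e' y d e : R) :
    (!![d', 0; 0, e'] : Matrix (Fin 2) (Fin 2) R) * !![1, y; 0, 1] * !![d, 0; 0, e] = !![d' * d, d' * y * e; 0, e' * e] := by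
  simp only [Matrix.mul_fin_two]; congr 1; ring_nf

/-- `!![d′, 0; 0, e′] · ū(z) · !![d, 0; 0, e] = !![d′d, 0; e′ z d, e′e]`. [cite: Rogawski1990, §1.10 p. 9] -/
theorem diag_mul_lower_mul_diag (d' e' z d e : R) :
    (!![d', 0; 0, e'] : Matrix (Fin 2) (Fin 2) R) * !![1, 0; z, 1] * !![d, 0; 0, e] = !![d' * d, 0; e' * z * d, e' * e] := by
  simp only [Matrix.mul_fin_two]; congr 1; ring_nf

/-- `ū(z) · u(y) = !![1, y; z, z y + 1]`. [cite: Casselman1995, Prop. 1.4.4] -/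
theorem lower_mul_upper (z y : R) :
    (!![1, 0; z, 1] : Matrix (Fin 2) (Fin 2) R) * !![1, y; 0, 1] = !![1, y; z, z * y + 1] := by
  simp only [Matrix.mul_fin_two]; congr 1; ring_nf

/-- `u(y) · ū(z) = !![1 + y z, y; z, 1]`. [cite: Casselman1995, Prop. 1.4.4] -/
theorem upper_mul_lower (y z : R) :
    (!![1, y; 0, 1] : Matrix (Fin 2) (Fin 2) R) * !![1, 0; z, 1] = !![1 + y * z, y; z, 1] := by
  simp only [Matrix.mul_fin_two]; congr 1; ring_nf

/-- **The conjugation triple product** `u(y′) · ū(z₁) · u(−y) = !![1 + y′z₁, y′ − y − y y′ z₁; z₁, 1 − z₁ y]`. [cite: HarishChandra1970, Lemma 22] [cite: Casselman1995, Prop. 1.4.4] -/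
theorem upper_mul_lower_mul_upper (y' z₁ y : R) :
    (!![1, y'; 0, 1] : Matrix (Fin 2) (Fin 2) R) * !![1, 0; z₁, 1] * !![1, -y; 0, 1] = !![1 + y' * z₁, y' - y - y * y' * z₁; z₁, 1 - z₁ * y] := by
  simp only [Matrix.mul_fin_two]; congr 1; ring_nf

/-- **The conjugation triple product, opposite orientation** `ū(z′) · u(y₁) · ū(−z) = !![1 − y₁ z, y₁; z′ − z − z z′ y₁, 1 + z′ y₁]`.
[cite: HarishChandra1970, Lemma 22] [cite: Casselman1995, Prop. 1.4.4] -/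
theorem lower_mul_upper_mul_lower (z' y₁ z : R) :
    (!![1, 0; z', 1] : Matrix (Fin 2) (Fin 2) R) * !![1, y₁; 0, 1] * !![1, 0; -z, 1] = !![1 - y₁ * z, y₁; z' - z - z * z' * y₁, 1 + z' * y₁] := by
  simp only [Matrix.mul_fin_two]; congr 1; ring_nf

/-- **THE `N̄·M·N` (IWAHORI) REFACTORISATION of a `2 × 2` matrix whose upper-left entry `p` has an inverse `p′` (`p′ p = 1`)** — the orientation of ★
`F0P3cIwahoriDatumU2Alg.coe_level_eq_mul`: `!![p, q; r, s] = ū(r p′) · !![p, 0; 0, s − r p′ q] · u(p′ q)`. [cite: Casselman1995, Prop. 1.4.4] -/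
theorem eq_lower_mul_diag_mul_upper (p q r s p' : R) (hp : p' * p = 1) :
    (!![p, q; r, s] : Matrix (Fin 2) (Fin 2) R) = !![1, 0; r * p', 1] * !![p, 0; 0, s - r * p' * q] * !![1, p' * q; 0, 1] := by
  ext i j
  fin_cases i <;> fin_cases j
  · simp [Matrix.mul_apply, Fin.sum_univ_two]
  · simp [Matrix.mul_apply, Fin.sum_univ_two]
    linear_combination (-q) * hp
  · simp [Matrix.mul_apply, Fin.sum_univ_two]
    linear_combination (-r) * hp
  · simp [Matrix.mul_apply, Fin.sum_univ_two]
    linear_combination (-(r * p' * q)) * hp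

/-- The determinant form of the Levi factor, opposite orientation: if `p s − q r = 1` and `p′ p = 1` then `s − r p′ q = p′`. [cite: Casselman1995, Prop. 1.4.4] -/
theorem sub_mul_mul_eq_of_det' (p q r s p' : R) (hp : p' * p = 1) (hdet : p * s - q * r = 1) : s - r * p' * q = p' := by
  linear_combination p' * hdet - s * hp

/-- **THE `N·M·N̄` (IWAHORI) REFACTORISATION of a `2 × 2` matrix whose lower-right entry `s` has an inverse `s′` (`s′ s = 1`)**:
`!![p, q; r, s] = u(q s′) · !![p − q s′ r, 0; 0, s] · ū(s′ r)`. [cite: Casselman1995, Prop. 1.4.4] -/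
theorem eq_upper_mul_diag_mul_lower (p q r s s' : R) (hs : s' * s = 1) :
    (!![p, q; r, s] : Matrix (Fin 2) (Fin 2) R) = !![1, q * s'; 0, 1] * !![p - q * s' * r, 0; 0, s] * !![1, 0; s' * r, 1] := by
  ext i j
  fin_cases i <;> fin_cases j
  · simp [Matrix.mul_apply, Fin.sum_univ_two]
    linear_combination (-(q * s' * r)) * hs
  · simp [Matrix.mul_apply, Fin.sum_univ_two]
    linear_combination (-q) * hs
  · simp [Matrix.mul_apply, Fin.sum_univ_two]
    linear_combination (-r) * hs
  · simp [Matrix.mul_apply, Fin.sum_univ_two]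

/-- The determinant form of the Levi factor: if `p s − q r = 1` and `s′ s = 1` then `p − q s′ r = s′`. [cite: Casselman1995, Prop. 1.4.4] -/
theorem sub_mul_mul_eq_of_det (p q r s s' : R) (hs : s' * s = 1) (hdet : p * s - q * r = 1) : p - q * s' * r = s' := by
  linear_combination s' * hdet - p * hs

end Identities

/-! ## §4 In the group: conjugating the unipotent elements by the torus (the twist of the van Dijk road) -/

section Twist

variable {R : Type*} [CommRing R] (σ : R →+* R) {J : Matrix (Fin 2) (Fin 2) R} (hJ : J = (StdForm.antidiagonal 2).over R)

include hJ in
/-- **`m⁻¹ · u(y) · m = u(σ(m₁₁) · y · m₁₁)`** for `m ∈ M` (`m = !![d, 0; 0, e]`, `m⁻¹ = !![σe, 0; 0, σd]`, `σe·d = 1`): the torus twists the upper root coordinate by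
`σ(e)·e = (d σd)⁻¹ = a(m)⁻¹` when `σ` is an involution. [cite: Rogawski1990, §1.10 p. 9] [cite: HarishChandra1970, Lemma 22] -/
theorem coe_inv_mul_mul_of_mem_torusU_of_eq_upper {m n : ↥(unitaryGroupOfForm σ J)} (hm : m ∈ torusU σ J) {y : R}
    (hn : ((n : GL (Fin 2) R) : Matrix (Fin 2) (Fin 2) R) = !![1, y; 0, 1]) :
    (((m⁻¹ * n * m : ↥(unitaryGroupOfForm σ J)) : GL (Fin 2) R) : Matrix (Fin 2) (Fin 2) R) =
      !![1, σ (((m : GL (Fin 2) R) : Matrix (Fin 2) (Fin 2) R) 1 1) * y * ((m : GL (Fin 2) R) : Matrix (Fin 2) (Fin 2) R) 1 1; 0, 1] := by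
  have hshape := coe_eq_diag_of_mem_torusU σ hm
  obtain ⟨hde, hed⟩ := map_entry_mul_entry_eq_one_of_mem_torusU σ hJ hm
  have hinv := coe_inv_eq_of_mem σ hJ m.2
  have e10 : ((m : GL (Fin 2) R) : Matrix (Fin 2) (Fin 2) R) 1 0 = 0 := by rw [hshape]; simp
  have e01 : ((m : GL (Fin 2) R) : Matrix (Fin 2) (Fin 2) R) 0 1 = 0 := by rw [hshape]; simp
  rw [e10, e01, map_zero] at hinv
  set d : R := ((m : GL (Fin 2) R) : Matrix (Fin 2) (Fin 2) R) 0 0 with hd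
  set e : R := ((m : GL (Fin 2) R) : Matrix (Fin 2) (Fin 2) R) 1 1 with he
  rw [Subgroup.coe_mul, Subgroup.coe_mul, Subgroup.coe_inv, Units.val_mul, Units.val_mul, hinv, hn, hshape,
    diag_mul_upper_mul_diag, hed, hde]

include hJ in
/-- **`m⁻¹ · ū(z) · m = ū(σ(m₀₀) · z · m₀₀)`** for `m ∈ M`: the torus twists the lower root coordinate by `σ(d)·d = a(m)`.
[cite: Rogawski1990, §1.10 p. 9] [cite: HarishChandra1970, Lemma 22] -/
theorem coe_inv_mul_mul_of_mem_torusU_of_eq_lower {m n : ↥(unitaryGroupOfForm σ J)} (hm : m ∈ torusU σ J) {z : R}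
    (hn : ((n : GL (Fin 2) R) : Matrix (Fin 2) (Fin 2) R) = !![1, 0; z, 1]) :
    (((m⁻¹ * n * m : ↥(unitaryGroupOfForm σ J)) : GL (Fin 2) R) : Matrix (Fin 2) (Fin 2) R) =
      !![1, 0; σ (((m : GL (Fin 2) R) : Matrix (Fin 2) (Fin 2) R) 0 0) * z * ((m : GL (Fin 2) R) : Matrix (Fin 2) (Fin 2) R) 0 0, 1] := by
  have hshape := coe_eq_diag_of_mem_torusU σ hm
  obtain ⟨hde, hed⟩ := map_entry_mul_entry_eq_one_of_mem_torusU σ hJ hm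
  have hinv := coe_inv_eq_of_mem σ hJ m.2
  have e10 : ((m : GL (Fin 2) R) : Matrix (Fin 2) (Fin 2) R) 1 0 = 0 := by rw [hshape]; simp
  have e01 : ((m : GL (Fin 2) R) : Matrix (Fin 2) (Fin 2) R) 0 1 = 0 := by rw [hshape]; simp
  rw [e10, e01, map_zero] at hinv
  set d : R := ((m : GL (Fin 2) R) : Matrix (Fin 2) (Fin 2) R) 0 0 with hd
  set e : R := ((m : GL (Fin 2) R) : Matrix (Fin 2) (Fin 2) R) 1 1 with he
  rw [Subgroup.coe_mul, Subgroup.coe_mul, Subgroup.coe_inv, Units.val_mul, Units.val_mul, hinv, hn, hshape,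
    diag_mul_lower_mul_diag, hed, hde]

end Twist

end Summit.HodgeConjecture.HodgeConjecture.Cruxes.H413.F0P3cStCharTSUpTrU2Chart
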